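import Mathlib
import Literature.Analysis.FluidPDE.VectorCalculus
import Literature.Analysis.FluidPDE.IsometryInvariance
import Literature.Analysis.FluidPDE.ClassicalSolutionGalilean
import HarnessLib

/-!
# Crux `PoloidalLiouville` (stmt-NavierStokesRegularity-1222, W1), crux idea «radial-jerk-tower» (ns-idea-15 g7):
# AFFINE CONJUGATION of the passive-vector (frozen-field / strain-shadow) operators

Support file (`--supports stmt-NavierStokesRegularity-1222`, helper).  Experiment cell `ns-wall-extremal`, width hand
ns-wall-eng-5 g8 (successor of g7), item (α) «FRAME-FREE STRAIN SHADOW» (critic of record ns-wall-crit-1 g5, batch #24 /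
08:31:10Z: size M, no strike).  0 kit.  TOOLS ONLY — no statement about a flow is made here.

The Defs twin `ThreadingFluxErtelTowerDefs` (p692432) states the strain-shadow Props (`InviscidStrainRigidity`,
`StrainShadowClassification`, `StrainShadowLiouville`, `StrainShadowSurvivor`) in the STANDARD FRAME: strain `S = diag(a,b,c)`,
centre `x₀ = 0`.  To transport them to an arbitrary triaxial strain `S` with orthonormal eigenframe and an arbitrary centre
`x₀` (file `ThreadingFluxErtelTowerStrainShadowFrameFree`) one conjugates a time-dependent field by the affine isometry
`y = R (x − x₀)` of a finite-dimensional real inner product space `E`: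

  `B′ t y := R (B t (x₀ + R⁻¹ y))`,   `u′ t y := R (u t (x₀ + R⁻¹ y))`.

This file packages, for a GENERAL linear isometry `R : E ≃ₗᵢ[ℝ] E`, centre `x₀` and GENERAL (time-dependent) drift `u`,
the pointwise and UNCONDITIONAL (no differentiability hypotheses: both sides carry the same junk values) transport of
every operator of the passive viscous vector equation `∂ₜB + (u·∇)B − (B·∇)u = νΔB`:

* `deriv_comp_linearIsometryEquiv` (`∂ₜ`), `fderiv_affConj` / `fderiv_affConj_apply` (`D`), `laplacian_comp_affine`,
  `laplacian_affConj` (`Δ`), `divergence_affConj` (`div`), `inner_affConj_self` (sphere tangency about the centre),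
  `norm_affConj` (boundedness);
* `passiveVectorLHS_affConj` — the whole left-hand side `∂ₜB′ + (u′·∇)B′ − (B′·∇)u′` at `y` is `R` of the unprimed one at
  `x = x₀ + R⁻¹y`; `passiveVector_affConj_iff` (`= νΔ`) and `frozenField_affConj_iff` (`= 0`);
* the LINEAR-STRAIN specialisation used by the strain shadow, with the conjugated strain given as any function `T` with
  `T (R z) = R (S z)`: `strainLHS_affConj`, `strainShadow_affConj_iff`, `inviscidStrain_affConj_iff`;
* the bookkeeping of the chart: `affChart_symm_apply`, `affChart_apply_symm`, `isOpen_affPreimage`,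
  `isPreconnected_affPreimage`, `contDiffOn_affConj` (joint space–time smoothness on `I ×ˢ U`).

Everything is a corollary of the TREE covariance lemmas `Literature.Analysis.FluidPDE.IsometryInvariance`
(`fderiv_conj_linearIsometryEquiv`, `divergence_conj_linearIsometryEquiv`, `laplacian_conj_linearIsometryEquiv`,
`laplacian_comp_linearIsometryEquiv_symm`; Majda–Bertozzi 2002 §1.2 Prop. 1.1) composed with the translation lemmas
(Mathlib `fderiv_comp_add_left`, Literature `laplacian_comp_add_right`).  Reusable for the kinematic shadow
(`InviscidKinematicRigidity`) and every «WLOG `x₀ = 0`, `S` diagonal» step of the lineage.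

HONEST FRAME: calculus bookkeeping; closes no crux or sketch Prop; `PoloidalLiouville` (1222) and NS regularity OPEN.
-/

-- the summit and its single problem share the name (D-0017 nested layout)
set_option linter.dupNamespace false

noncomputable section

namespace Summit.NavierStokesRegularity.NavierStokesRegularity.Theorems.PoloidalLiouville.ErtelTower

open Set Function
open scoped Topology RealInnerProductSpace InnerProductSpace Laplacian ContDiff
open Literature.Analysis.FluidPDE

variable {E : Type*} [NormedAddCommGroup E] [InnerProductSpace ℝ E]
variable {F : Type*} [NormedAddCommGroup F] [NormedSpace ℝ F]

/-! ### The affine chart `y ↦ x₀ + R⁻¹ y` -/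

section Chart

variable (R : E ≃ₗᵢ[ℝ] E) (x₀ : E)

/-- The chart inverts `x ↦ R (x − x₀)`: `x₀ + R⁻¹(R(x − x₀)) = x`. -/
theorem affChart_apply_symm (x : E) : x₀ + R.symm (R (x - x₀)) = x := by
  rw [LinearIsometryEquiv.symm_apply_apply, add_sub_cancel]

/-- `R ((x₀ + R⁻¹ y) − x₀) = y`. -/
theorem affChart_symm_apply (y : E) : R (x₀ + R.symm y - x₀) = y := by
  rw [add_sub_cancel_left, LinearIsometryEquiv.apply_symm_apply]

/-- `(x₀ + R⁻¹ y) − x₀ = R⁻¹ y`. -/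
theorem affChart_sub (y : E) : x₀ + R.symm y - x₀ = R.symm y :=
  add_sub_cancel_left x₀ (R.symm y)

/-- The chart as a homeomorphism (`R⁻¹` followed by the translation by `x₀`). -/
theorem coe_affHomeomorph :
    ⇑(R.symm.toHomeomorph.trans (Homeomorph.addLeft x₀)) = fun y => x₀ + R.symm y := rfl

/-- The chart pulls open sets back to open sets. -/
theorem isOpen_affPreimage {U : Set E} (hU : IsOpen U) : IsOpen ((fun y => x₀ + R.symm y) ⁻¹' U) := by
  rw [← coe_affHomeomorph]
  exact hU.preimage (Homeomorph.continuous _)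

/-- The chart pulls preconnected sets back to preconnected sets. -/
theorem isPreconnected_affPreimage {U : Set E} (hU : IsPreconnected U) :
    IsPreconnected ((fun y => x₀ + R.symm y) ⁻¹' U) := by
  rw [← coe_affHomeomorph, Homeomorph.isPreconnected_preimage]
  exact hU

/-- `x ∈ U` iff its chart coordinate `R (x − x₀)` lies in the pulled-back set. -/
theorem mem_affPreimage_iff {U : Set E} (x : E) :
    R (x - x₀) ∈ (fun y => x₀ + R.symm y) ⁻¹' U ↔ x ∈ U := by
  rw [mem_preimage, affChart_apply_symm]

/-- The whole space pulls back to the whole space. -/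
theorem affPreimage_univ : (fun y => x₀ + R.symm y) ⁻¹' (univ : Set E) = univ := preimage_univ

end Chart

/-! ### Pointwise transport of the operators (unconditional) -/

section Pointwise

variable (R : E ≃ₗᵢ[ℝ] E) (x₀ : E)

/-- `∂ₜ` commutes with a linear isometry acting on the values: `(R ∘ g)′(t) = R (g′(t))` — with NO differentiability
hypothesis (if `g` is not differentiable at `t`, neither is `R ∘ g`, and both sides are `0`). -/
theorem deriv_comp_linearIsometryEquiv (g : ℝ → E) (t : ℝ) :
    deriv (fun s => R (g s)) t = R (deriv g t) := by
  rw [← fderiv_apply_one_eq_deriv, ← fderiv_apply_one_eq_deriv, show (fun s => R (g s)) = R ∘ g from rfl, R.comp_fderiv]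
  rfl

/-- Chain rule for the conjugated field: `D(R ∘ f ∘ (x₀ + R⁻¹·))(y) = R ∘ Df(x₀ + R⁻¹y) ∘ R⁻¹` (unconditional). -/
theorem fderiv_affConj (f : E → E) (y : E) :
    fderiv ℝ (fun y => R (f (x₀ + R.symm y))) y =
      (R : E →L[ℝ] E).comp ((fderiv ℝ f (x₀ + R.symm y)).comp (R.symm : E →L[ℝ] E)) := by
  have h := fderiv_conj_linearIsometryEquiv R (fun z => f (x₀ + z)) y
  rw [fderiv_comp_add_left] at h
  exact h

/-- Chain rule for the conjugated field, applied to a vector: `D B′(y) w = R (D B(x) (R⁻¹ w))`, `x = x₀ + R⁻¹y`. -/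
theorem fderiv_affConj_apply (f : E → E) (y w : E) :
    fderiv ℝ (fun y => R (f (x₀ + R.symm y))) y w = R (fderiv ℝ f (x₀ + R.symm y) (R.symm w)) := by
  rw [fderiv_affConj]
  rfl

/-- Chain rule for a conjugated scalar (or vector) field without rotation of the values:
`D(g ∘ (x₀ + R⁻¹·))(y) = Dg(x₀ + R⁻¹y) ∘ R⁻¹` (unconditional). -/
theorem fderiv_comp_affine (g : E → F) (y : E) :
    fderiv ℝ (fun y => g (x₀ + R.symm y)) y = (fderiv ℝ g (x₀ + R.symm y)).comp (R.symm : E →L[ℝ] E) := by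
  have h := fderiv_comp_linearIsometryEquiv_symm R (fun z => g (x₀ + z)) y
  rw [fderiv_comp_add_left] at h
  exact h

variable [FiniteDimensional ℝ E]

/-- The Laplacian is invariant under the affine chart: `Δ(g ∘ (x₀ + R⁻¹·))(y) = Δg (x₀ + R⁻¹y)` (unconditional). -/
theorem laplacian_comp_affine (g : E → F) (y : E) :
    (Δ (fun y => g (x₀ + R.symm y))) y = (Δ g) (x₀ + R.symm y) := by
  have h := laplacian_comp_linearIsometryEquiv_symm R (fun z => g (x₀ + z)) y
  have h2 : (fun z => g (x₀ + z)) = fun z => g (z + x₀) := by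
    funext z; rw [add_comm]
  rw [h2, laplacian_comp_add_right, add_comm (R.symm y) x₀] at h
  exact h

/-- The Laplacian of the conjugated vector field: `Δ B′(y) = R (Δ B (x₀ + R⁻¹y))` (unconditional). -/
theorem laplacian_affConj (f : E → E) (y : E) :
    (Δ (fun y => R (f (x₀ + R.symm y)))) y = R ((Δ f) (x₀ + R.symm y)) := by
  have h := laplacian_conj_linearIsometryEquiv R (fun z => f (x₀ + z)) y
  have h2 : (fun z => f (x₀ + z)) = fun z => f (z + x₀) := by
    funext z; rw [add_comm]
  rw [h2, laplacian_comp_add_right, add_comm (R.symm y) x₀] at h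
  exact h

/-- The divergence of the conjugated vector field: `div B′(y) = div B (x₀ + R⁻¹y)` (unconditional). -/
theorem divergence_affConj (f : E → E) (y : E) :
    VectorCalculus.divergence (fun y => R (f (x₀ + R.symm y))) y = VectorCalculus.divergence f (x₀ + R.symm y) := by
  have h := divergence_conj_linearIsometryEquiv R (fun z => f (x₀ + z)) y
  rw [h]
  unfold VectorCalculus.divergence
  rw [fderiv_comp_add_left]

omit [FiniteDimensional ℝ E] in
/-- Sphere tangency about the centre is transported to sphere tangency about `0`:
`⟪R v, y⟫ = ⟪v, (x₀ + R⁻¹y) − x₀⟫`. -/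
theorem inner_affConj_self (v y : E) : ⟪R v, y⟫ = ⟪v, x₀ + R.symm y - x₀⟫ := by
  rw [affChart_sub, LinearIsometryEquiv.inner_map_eq_flip]

omit [FiniteDimensional ℝ E] in
/-- Norms are transported verbatim. -/
theorem norm_affConj (v : E) : ‖R v‖ = ‖v‖ := R.norm_map v

end Pointwise

/-! ### The passive-vector left-hand side -/

section Passive

variable [FiniteDimensional ℝ E] (R : E ≃ₗᵢ[ℝ] E) (x₀ : E)

omit [FiniteDimensional ℝ E] in
/-- **Transport of the passive-vector operator (general drift).**  With `B′ t y = R (B t (x₀ + R⁻¹y))`,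
`u′ t y = R (u t (x₀ + R⁻¹y))` and `x = x₀ + R⁻¹y`:
`∂ₜB′ + (u′·∇)B′ − (B′·∇)u′` at `(t,y)` equals `R` applied to `∂ₜB + (u·∇)B − (B·∇)u` at `(t,x)` — unconditionally. -/
theorem passiveVectorLHS_affConj (u B : ℝ → E → E) (t : ℝ) (y : E) :
    deriv (fun s => R (B s (x₀ + R.symm y))) t
        + fderiv ℝ (fun y => R (B t (x₀ + R.symm y))) y (R (u t (x₀ + R.symm y)))
        - fderiv ℝ (fun y => R (u t (x₀ + R.symm y))) y (R (B t (x₀ + R.symm y)))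
      = R (deriv (fun s => B s (x₀ + R.symm y)) t
          + fderiv ℝ (B t) (x₀ + R.symm y) (u t (x₀ + R.symm y))
          - fderiv ℝ (u t) (x₀ + R.symm y) (B t (x₀ + R.symm y))) := by
  rw [deriv_comp_linearIsometryEquiv R (fun s => B s (x₀ + R.symm y)) t, fderiv_affConj_apply,
    fderiv_affConj_apply, LinearIsometryEquiv.symm_apply_apply, LinearIsometryEquiv.symm_apply_apply, map_sub,
    map_add]

/-- **The viscous passive-vector equation is affinely covariant**: `B′` solves `∂ₜB′ + (u′·∇)B′ − (B′·∇)u′ = νΔB′` at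
`(t,y)` iff `B` solves `∂ₜB + (u·∇)B − (B·∇)u = νΔB` at `(t, x₀ + R⁻¹y)`. -/
theorem passiveVector_affConj_iff (ν : ℝ) (u B : ℝ → E → E) (t : ℝ) (y : E) :
    deriv (fun s => R (B s (x₀ + R.symm y))) t
        + fderiv ℝ (fun y => R (B t (x₀ + R.symm y))) y (R (u t (x₀ + R.symm y)))
        - fderiv ℝ (fun y => R (u t (x₀ + R.symm y))) y (R (B t (x₀ + R.symm y)))
      = ν • (Δ (fun y => R (B t (x₀ + R.symm y)))) y ↔
    deriv (fun s => B s (x₀ + R.symm y)) t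
        + fderiv ℝ (B t) (x₀ + R.symm y) (u t (x₀ + R.symm y))
        - fderiv ℝ (u t) (x₀ + R.symm y) (B t (x₀ + R.symm y))
      = ν • (Δ (B t)) (x₀ + R.symm y) := by
  rw [passiveVectorLHS_affConj, laplacian_affConj, ← LinearIsometryEquiv.map_smul, R.injective.eq_iff]

omit [FiniteDimensional ℝ E] in
/-- **The frozen-field equation is affinely covariant**: `∂ₜB′ + (u′·∇)B′ − (B′·∇)u′ = 0` at `(t,y)` iff
`∂ₜB + (u·∇)B − (B·∇)u = 0` at `(t, x₀ + R⁻¹y)`. -/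
theorem frozenField_affConj_iff (u B : ℝ → E → E) (t : ℝ) (y : E) :
    deriv (fun s => R (B s (x₀ + R.symm y))) t
        + fderiv ℝ (fun y => R (B t (x₀ + R.symm y))) y (R (u t (x₀ + R.symm y)))
        - fderiv ℝ (fun y => R (u t (x₀ + R.symm y))) y (R (B t (x₀ + R.symm y))) = 0 ↔
    deriv (fun s => B s (x₀ + R.symm y)) t
        + fderiv ℝ (B t) (x₀ + R.symm y) (u t (x₀ + R.symm y))
        - fderiv ℝ (u t) (x₀ + R.symm y) (B t (x₀ + R.symm y)) = 0 := by
  rw [passiveVectorLHS_affConj, ← (map_zero R), R.injective.eq_iff]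
  rw [map_zero]

end Passive

/-! ### The linear-strain specialisation -/

section Strain

variable [FiniteDimensional ℝ E] (R : E ≃ₗᵢ[ℝ] E) (x₀ : E)

omit [FiniteDimensional ℝ E] in
/-- **Transport of the strain-shadow operator.**  Let `S : E →L[ℝ] E` be the strain about the centre `x₀` (drift
`S(x − x₀)`, stretching term `S B`) and `T : E → E` its conjugate in the chart, `T (R z) = R (S z)`.  With
`B′ t y = R (B t (x₀ + R⁻¹y))` and `x = x₀ + R⁻¹y`:
`∂ₜB′(t,y) + DB′(t,y)[T y] − T (B′ t y) = R (∂ₜB(t,x) + DB(t,x)[S(x − x₀)] − S (B t x))` — unconditionally. -/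
theorem strainLHS_affConj (S : E →L[ℝ] E) (T : E → E) (hT : ∀ z, T (R z) = R (S z)) (B : ℝ → E → E) (t : ℝ) (y : E) :
    deriv (fun s => R (B s (x₀ + R.symm y))) t + fderiv ℝ (fun y => R (B t (x₀ + R.symm y))) y (T y)
        - T (R (B t (x₀ + R.symm y)))
      = R (deriv (fun s => B s (x₀ + R.symm y)) t
          + fderiv ℝ (B t) (x₀ + R.symm y) (S (x₀ + R.symm y - x₀)) - S (B t (x₀ + R.symm y))) := by
  have hTy : T y = R (S (R.symm y)) := by
    rw [← hT, LinearIsometryEquiv.apply_symm_apply]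
  rw [deriv_comp_linearIsometryEquiv R (fun s => B s (x₀ + R.symm y)) t, fderiv_affConj_apply, hTy, hT,
    LinearIsometryEquiv.symm_apply_apply, affChart_sub, map_sub, map_add]

/-- **The viscous strain-shadow equation is affinely covariant**: with `T (R z) = R (S z)`,
`∂ₜB′ + DB′[T y] − T B′ = νΔB′` at `(t,y)` iff `∂ₜB + DB[S(x − x₀)] − S B = νΔB` at `(t, x)`, `x = x₀ + R⁻¹y`. -/
theorem strainShadow_affConj_iff (ν : ℝ) (S : E →L[ℝ] E) (T : E → E) (hT : ∀ z, T (R z) = R (S z))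
    (B : ℝ → E → E) (t : ℝ) (y : E) :
    deriv (fun s => R (B s (x₀ + R.symm y))) t + fderiv ℝ (fun y => R (B t (x₀ + R.symm y))) y (T y)
        - T (R (B t (x₀ + R.symm y))) = ν • (Δ (fun y => R (B t (x₀ + R.symm y)))) y ↔
    deriv (fun s => B s (x₀ + R.symm y)) t + fderiv ℝ (B t) (x₀ + R.symm y) (S (x₀ + R.symm y - x₀))
        - S (B t (x₀ + R.symm y)) = ν • (Δ (B t)) (x₀ + R.symm y) := by
  rw [strainLHS_affConj R x₀ S T hT, laplacian_affConj, ← LinearIsometryEquiv.map_smul, R.injective.eq_iff]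

omit [FiniteDimensional ℝ E] in
/-- **The frozen-field equation in a linear strain is affinely covariant**: with `T (R z) = R (S z)`,
`∂ₜB′ + DB′[T y] − T B′ = 0` at `(t,y)` iff `∂ₜB + DB[S(x − x₀)] − S B = 0` at `(t, x)`, `x = x₀ + R⁻¹y`. -/
theorem inviscidStrain_affConj_iff (S : E →L[ℝ] E) (T : E → E) (hT : ∀ z, T (R z) = R (S z))
    (B : ℝ → E → E) (t : ℝ) (y : E) :
    deriv (fun s => R (B s (x₀ + R.symm y))) t + fderiv ℝ (fun y => R (B t (x₀ + R.symm y))) y (T y)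
        - T (R (B t (x₀ + R.symm y))) = 0 ↔
    deriv (fun s => B s (x₀ + R.symm y)) t + fderiv ℝ (B t) (x₀ + R.symm y) (S (x₀ + R.symm y - x₀))
        - S (B t (x₀ + R.symm y)) = 0 := by
  rw [strainLHS_affConj R x₀ S T hT]
  constructor
  · intro h
    exact R.injective (by rw [h, map_zero])
  · intro h
    rw [h, map_zero]

end Strain

/-! ### Joint space–time smoothness -/

section Smooth

variable (R : E ≃ₗᵢ[ℝ] E) (x₀ : E)

/-- The chart `(t,y) ↦ (t, x₀ + R⁻¹y)` is smooth and maps `I ×ˢ (chart⁻¹ U)` into `I ×ˢ U`; composition on the right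
preserves joint space–time smoothness of any field `w : ℝ → E → F`. -/
theorem contDiffOn_comp_affine {n : WithTop ℕ∞} {w : ℝ → E → F} {I : Set ℝ} {U : Set E}
    (hw : ContDiffOn ℝ n (uncurry w) (I ×ˢ U)) :
    ContDiffOn ℝ n (uncurry fun t y => w t (x₀ + R.symm y)) (I ×ˢ ((fun y => x₀ + R.symm y) ⁻¹' U)) := by
  have h1 : uncurry (fun t y => w t (x₀ + R.symm y)) = uncurry w ∘ fun z : ℝ × E => (z.1, x₀ + R.symm z.2) := by
    funext z; rfl
  rw [h1]
  refine hw.comp ?_ fun z hz => ⟨hz.1, hz.2⟩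
  exact (contDiff_fst.prodMk
    (contDiff_const.add (R.symm.toContinuousLinearEquiv.contDiff.comp contDiff_snd))).contDiffOn

/-- Joint space–time smoothness of the conjugated vector field `B′ t y = R (B t (x₀ + R⁻¹y))` on `I ×ˢ (chart⁻¹ U)`. -/
theorem contDiffOn_affConj {n : WithTop ℕ∞} {B : ℝ → E → E} {I : Set ℝ} {U : Set E}
    (hB : ContDiffOn ℝ n (uncurry B) (I ×ˢ U)) :
    ContDiffOn ℝ n (uncurry fun t y => R (B t (x₀ + R.symm y))) (I ×ˢ ((fun y => x₀ + R.symm y) ⁻¹' U)) := by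
  have h1 : uncurry (fun t y => R (B t (x₀ + R.symm y))) =
      R.toContinuousLinearEquiv ∘ uncurry (fun t y => B t (x₀ + R.symm y)) := by
    funext z; rfl
  rw [h1]
  exact R.toContinuousLinearEquiv.contDiff.comp_contDiffOn (contDiffOn_comp_affine R x₀ hB)

end Smooth

/-! ### Transport of the strain-shadow HYPOTHESES on `I × U` (the form consumed by the Defs twin's Props) -/

section Hypotheses

variable [FiniteDimensional ℝ E] (R : E ≃ₗᵢ[ℝ] E) (x₀ : E) {B : ℝ → E → E} {I : Set ℝ} {U : Set E}

/-- Divergence-freeness passes to the conjugated field on the pulled-back set. -/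
theorem affConj_divFree (hdiv : ∀ t ∈ I, ∀ x ∈ U, VectorCalculus.divergence (B t) x = 0) :
    ∀ t ∈ I, ∀ y ∈ (fun y => x₀ + R.symm y) ⁻¹' U,
      VectorCalculus.divergence (fun y => R (B t (x₀ + R.symm y))) y = 0 := fun t ht y hy => by
  rw [divergence_affConj]
  exact hdiv t ht _ hy

omit [FiniteDimensional ℝ E] in
/-- Sphere tangency about `x₀` passes to sphere tangency about `0`. -/
theorem affConj_tangent (htan : ∀ t ∈ I, ∀ x ∈ U, ⟪B t x, x - x₀⟫ = 0) :
    ∀ t ∈ I, ∀ y ∈ (fun y => x₀ + R.symm y) ⁻¹' U, ⟪R (B t (x₀ + R.symm y)), y⟫ = 0 := fun t ht y hy => by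
  rw [inner_affConj_self R x₀]
  exact htan t ht _ hy

/-- The viscous strain-shadow equation (strain `S` about `x₀`) passes to the conjugated field with the conjugated strain
`T`, `T (R z) = R (S z)`, about `0`. -/
theorem affConj_strainPDE (ν : ℝ) (S : E →L[ℝ] E) (T : E → E) (hT : ∀ z, T (R z) = R (S z))
    (hpde : ∀ t ∈ I, ∀ x ∈ U,
      deriv (fun s => B s x) t + fderiv ℝ (B t) x (S (x - x₀)) - S (B t x) = ν • (Δ (B t)) x) :
    ∀ t ∈ I, ∀ y ∈ (fun y => x₀ + R.symm y) ⁻¹' U,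
      deriv (fun s => R (B s (x₀ + R.symm y))) t + fderiv ℝ (fun y => R (B t (x₀ + R.symm y))) y (T y)
        - T (R (B t (x₀ + R.symm y))) = ν • (Δ (fun y => R (B t (x₀ + R.symm y)))) y :=
  fun t ht y hy => (strainShadow_affConj_iff R x₀ ν S T hT B t y).mpr (hpde t ht _ hy)

omit [FiniteDimensional ℝ E] in
/-- The frozen-field equation in the strain `S` about `x₀` passes to the conjugated field with the conjugated strain `T`
about `0`. -/
theorem affConj_inviscidPDE (S : E →L[ℝ] E) (T : E → E) (hT : ∀ z, T (R z) = R (S z))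
    (hpde : ∀ t ∈ I, ∀ x ∈ U, deriv (fun s => B s x) t + fderiv ℝ (B t) x (S (x - x₀)) - S (B t x) = 0) :
    ∀ t ∈ I, ∀ y ∈ (fun y => x₀ + R.symm y) ⁻¹' U,
      deriv (fun s => R (B s (x₀ + R.symm y))) t + fderiv ℝ (fun y => R (B t (x₀ + R.symm y))) y (T y)
        - T (R (B t (x₀ + R.symm y))) = 0 :=
  fun t ht y hy => (inviscidStrain_affConj_iff R x₀ S T hT B t y).mpr (hpde t ht _ hy)

omit [FiniteDimensional ℝ E] in
/-- A uniform bound passes to the conjugated field verbatim. -/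
theorem affConj_bounded (hbd : ∃ C : ℝ, ∀ t ∈ I, ∀ x, ‖B t x‖ ≤ C) :
    ∃ C : ℝ, ∀ t ∈ I, ∀ y, ‖R (B t (x₀ + R.symm y))‖ ≤ C := by
  obtain ⟨C, hC⟩ := hbd
  exact ⟨C, fun t ht y => by rw [norm_affConj]; exact hC t ht _⟩

end Hypotheses

end Summit.NavierStokesRegularity.NavierStokesRegularity.Theorems.PoloidalLiouville.ErtelTower

end
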